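import Mathlib
import HarnessLib
import Summits.CriticalPhenomena.PercolationContinuityZ3.Theses.PercLowPointHalfSpace
import Literature.Probability.Percolation.HutchcroftVolumeTail
import Literature.Probability.Percolation.HalfSpace

/-!
# Sketch — first lemmas for the crux ideas on `QuantitativeBGN` (stmt-CriticalPhenomena-0913)

Planner scratch (crux-ideate round 1, ideator 1).  Nothing here is proved; every `def … : Prop`
must elaborate.  `u r = P_{p_c}(arm_H(0,r))` is literally the crux's event.
-/

namespace Summit.CriticalPhenomena.PercolationContinuityZ3.Cruxes.QuantitativeBGN.Sketch1

open MeasureTheory Filter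
open Literature.Probability.Percolation Literature.Probability.LatticeModels
open scoped ENNReal Topology

/-- The half-space `H = {x₀ ≥ 0}` of `ℤ³` (the crux's set). -/
def H : Set (Site 3) := {x | 0 ≤ x 0}

/-- The crux's event `arm_H(0,r)`: the `H`-cluster of `0` reaches sup-distance `≥ r`. -/
def armH (r : ℕ) : Set (BondConfig (Site 3)) :=
  {ω | ∃ y : Site 3, (∃ i : Fin 3, (r : ℤ) ≤ |y i|) ∧ ω ∈ openConnIn H 0 y}

/-- `P_p` on `ℤ³`. -/
noncomputable abbrev P (p : unitInterval) : Measure (BondConfig (Site 3)) :=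
  bondPercolation (zdGraph 3) p

/-- `u r = P_{p_c}(arm_H(0,r))`. -/
noncomputable def u (r : ℕ) : ℝ := (P (criticalProbI 3)).real (armH r)

/-- Sanity: the crux is literally `∃ a C, 0 < a ∧ ∀ r ≥ 1, u r ≤ C r^{-a}`. -/
example : Theses.PercLowPointHalfSpace.QuantitativeBGN ↔
    ∃ a C : ℝ, 0 < a ∧ ∀ r : ℕ, 1 ≤ r → u r ≤ C * (r : ℝ) ^ (-a) := Iff.rfl

/-- The SURFACE susceptibility `χ_H(p) = E_p|C_H(0)| = Σ_x P_p(0 ↔ x in H)` as an `ℝ≥0∞` sum. -/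
noncomputable def surfaceSusc (p : unitInterval) : ℝ≥0∞ := ∑' x : Site 3, P p (openConnIn H 0 x)

/-! ## Card 1 — entropic (KL) transfer: `QuantitativeBGN` from a sub-quadratic surface susceptibility -/

/-- FIRST LEMMA (card `kl-surface-susceptibility-transfer`): the Dewan–Muirhead / Hutchcroft
relative-entropy comparison `p_c` versus `p < p_c`, run on the half-space graph (max degree 6, the
tree's `ClusterExploration.real_clusterSizeGe_le_of_kl`), followed by Markov: for every
`p ∈ (0, p_c)` and every `M ≥ χ_H(p)`,
`u r ≤ M · (2/r + 48 · kl(p ‖ p_c))`.  (`arm_H(0,r) ⊆ {|C_H(0)| ≥ r}`,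
`Σ_{j≤r} P_p(|C_H| ≥ j) ≤ χ_H(p)`, `P_p(|C_H(0)| ≥ r) ≤ χ_H(p)/r`.) -/
def KLSurfaceBound : Prop :=
  ∀ p : unitInterval, 0 < (p : ℝ) → (p : ℝ) < criticalProbI 3 →
    ∀ M : ℝ, 0 ≤ M → surfaceSusc p ≤ ENNReal.ofReal M →
      ∀ r : ℕ, 1 ≤ r →
        u r ≤ M * (2 / (r : ℝ) + 48 * Literature.Probability.Entropy.binaryKL (p : ℝ) (criticalProbI 3 : ℝ))

/-- TRANSFER TARGET `C⁺` (card 1): the surface susceptibility exponent is `< 2` — a power-law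
upper bound `χ_H(p) ≤ C (p_c - p)^{-γ₁}` with `γ₁ < 2` on a left neighbourhood of `p_c`
(numerically `γ₁ = ν(2 - η_⊥) ≈ 1.3`; any bulk bound `χ(p) ≤ C(p_c-p)^{-γ}`, `γ < 2`, implies it). -/
def SurfaceGammaSubQuadratic : Prop :=
  ∃ γ C δ : ℝ, γ < 2 ∧ 0 < C ∧ 0 < δ ∧
    ∀ p : unitInterval, (criticalProbI 3 : ℝ) - δ < p → (p : ℝ) < criticalProbI 3 →
      surfaceSusc p ≤ ENNReal.ofReal (C * ((criticalProbI 3 : ℝ) - p) ^ (-γ))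

/-- The composition claimed by card 1 (real analysis only: take `p = p_c - r^{-1/2}`,
`kl(p‖p_c) ≤ (p_c-p)²/(p_c(1-p_c))`; output exponent `a = 1 - γ₁/2`). -/
def KLTransfer : Prop :=
  KLSurfaceBound → SurfaceGammaSubQuadratic → Theses.PercLowPointHalfSpace.QuantitativeBGN

/-! ## Card 2 — soft anchor: BGN's qualitative zero + sub-multiplicativity ⇒ a power law -/

/-- The half-ball-to-far event `U(r,R)`: some vertex of `B_r ∩ H` is joined inside `H` to
sup-distance `≥ R` (from `0`). -/
def halfBallFar (r R : ℕ) : Set (BondConfig (Site 3)) :=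
  {ω | ∃ x y : Site 3, (∀ i : Fin 3, |x i| ≤ (r : ℤ)) ∧ (∃ i : Fin 3, (R : ℤ) ≤ |y i|) ∧
    ω ∈ openConnIn H x y}

/-- LOAD-BEARING STUB of card 2 (scale comparison, "a half-ball at scale `r` is no better than a
point at scale `1`"): `P_{p_c}(U(r, rs)) ≤ C · u s`. With the (free) independence
`u(rs) ≤ u(r) · P(U(r,rs))` this is sub-multiplicativity of `u`. -/
def HalfBallComparison : Prop :=
  ∃ C : ℝ, 0 < C ∧ ∀ r s : ℕ, 1 ≤ r → 1 ≤ s →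
    (P (criticalProbI 3)).real (halfBallFar r (r * s)) ≤ C * u s

/-- Sub-multiplicativity of the boundary one-arm. -/
def Submultiplicative : Prop :=
  ∃ C : ℝ, 0 < C ∧ ∀ r s : ℕ, 1 ≤ r → 1 ≤ s → u (r * s) ≤ C * u r * u s

/-- SOFT ANCHOR (provable now from `BarskyGrimmettNewman1991_Z3_holds` by continuity from above:
`⋂_r arm_H(0,r) = {C_H(0) infinite}`). -/
def SoftAnchor : Prop := Tendsto u atTop (𝓝 0)

/-- FIRST LEMMA of card 2 (Fekete-type, pure real analysis; provable now): an antitone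
nonnegative sub-multiplicative sequence tending to `0` decays polynomially. -/
def FeketeStep : Prop :=
  ∀ v : ℕ → ℝ, (∀ n, 0 ≤ v n) → Antitone v →
    (∃ C : ℝ, 0 < C ∧ ∀ r s : ℕ, 1 ≤ r → 1 ≤ s → v (r * s) ≤ C * v r * v s) →
    Tendsto v atTop (𝓝 0) →
    ∃ a C' : ℝ, 0 < a ∧ ∀ r : ℕ, 1 ≤ r → v r ≤ C' * (r : ℝ) ^ (-a)

/-- The composition claimed by card 2. -/
def SoftAnchorLine : Prop :=
  FeketeStep → SoftAnchor → Submultiplicative → Theses.PercLowPointHalfSpace.QuantitativeBGN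

end Summit.CriticalPhenomena.PercolationContinuityZ3.Cruxes.QuantitativeBGN.Sketch1
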